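import Mathlib
import Literature.Computability.Complexity.RangeAvoidance
import Summits.PneNP.PneNP.Theorems.PstarSALevel

/-!
# Sherali–Adams feasibility from consistent laws on CLOSED sets (BGMT Lemma 2.3 with closures) — cell `pnp-ideate`, ROUND-21

FRONTIER range-avoidance ladder, rung F-N3 context (restricted-model lower bounds for the Sherali–Adams hierarchy on typed
`P⋆`; nothing here bears on `P` vs `NP`).

The Benabbas–Georgiou–Magen–Tulsiani construction (Theory Comput. 8 (2012)) produces local laws `P(S')` only for CLOSED
variable sets `S'` (advice sets, `PstarSAClosure.exists_closure`) and proves marginal consistency `P(S₂)|_{S₁} = P(S₁)` for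
nested pairs with `S₁` closed (their Lemma 3.2).  This file is the formal glue (their Lemma 2.3) into the tree's
`PstarSALevel.SAFeasible`: with `D(S) := P(cl S)` for a closure operator `cl`, consistency for `T ⊆ S` follows through the
common refinement `cl S ∪ cl T`.  Everything here is abstract in the closure `cl`, the predicate `Closed` and the laws
`P`; the suppliers are the closure file (`Closed (cl S)`, size budget) and the peeling/consistency files (laws, Lemma 3.2).

* `cyl_eq_of_subset` — two laws that agree on every `V`-cylinder agree on every `U`-cylinder, `U ⊆ V`;
* `saFeasible_of_closure` — the assembly.
-/

set_option linter.dupNamespace false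

open Finset Literature.Computability.Complexity
open Summit.PneNP.PneNP.Theorems.PstarSALevel (cyl varSet SAFeasible)

namespace Summit.PneNP.PneNP.Theorems.PstarSAAssembly

variable {k n m : ℕ}

/-! ## Cylinders refine -/

/-- The assignments agreeing with `a` on `U`. -/
def cylSet (U : Finset (Fin n)) (a : Fin n → Bool) : Finset (Fin n → Bool) :=
  univ.filter fun x => ∀ i ∈ U, x i = a i

/-- `cyl D U a` is the `D`-mass of `cylSet U a`. -/
theorem cyl_eq_sum (D : (Fin n → Bool) → ℝ) (U : Finset (Fin n)) (a : Fin n → Bool) :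
    cyl D U a = ∑ x ∈ cylSet U a, D x := rfl

/-- The canonical representative of an assignment on `V`: keep `V`, zero elsewhere. -/
def canon (V : Finset (Fin n)) (x : Fin n → Bool) : Fin n → Bool := fun i => if i ∈ V then x i else false

/-- The canonical representatives of the `V`-patterns that agree with `a` on `U`. -/
def reps (U V : Finset (Fin n)) (a : Fin n → Bool) : Finset (Fin n → Bool) :=
  univ.filter fun c => (∀ i ∈ U, c i = a i) ∧ ∀ i, i ∉ V → c i = false

/-- A `U`-cylinder is the disjoint union of the `V`-cylinders of its canonical `V`-patterns (`U ⊆ V`). -/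
theorem cylSet_eq_biUnion (U V : Finset (Fin n)) (hUV : U ⊆ V) (a : Fin n → Bool) :
    cylSet U a = (reps U V a).biUnion fun c => cylSet V c := by
  ext x
  simp only [cylSet, reps, Finset.mem_filter, Finset.mem_univ, true_and, Finset.mem_biUnion]
  constructor
  · intro hx
    refine ⟨canon V x, ⟨fun i hi => ?_, fun i hi => ?_⟩, fun i hi => ?_⟩
    · simp only [canon, if_pos (hUV hi)]; exact hx i hi
    · simp only [canon, if_neg hi]
    · simp only [canon, if_pos hi]
  · rintro ⟨c, ⟨hcU, -⟩, hxc⟩ i hi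
    rw [hxc i (hUV hi)]; exact hcU i hi

/-- Distinct canonical patterns have disjoint `V`-cylinders. -/
theorem pairwiseDisjoint_reps (U V : Finset (Fin n)) (a : Fin n → Bool) :
    (reps U V a : Set (Fin n → Bool)).PairwiseDisjoint fun c => cylSet V c := by
  intro c hc c' hc' hne
  rw [Function.onFun, Finset.disjoint_left]
  intro x hx hx'
  apply hne
  funext i
  simp only [reps, Finset.coe_filter, Set.mem_setOf_eq, Finset.mem_univ, true_and] at hc hc'
  simp only [cylSet, Finset.mem_filter, Finset.mem_univ, true_and] at hx hx'
  by_cases hi : i ∈ V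
  · rw [← hx i hi, ← hx' i hi]
  · rw [hc.2 i hi, hc'.2 i hi]

/-- **Cylinders refine**: two laws that agree on all `V`-cylinders agree on all `U`-cylinders for `U ⊆ V`. -/
theorem cyl_eq_of_subset (D D' : (Fin n → Bool) → ℝ) (U V : Finset (Fin n)) (hUV : U ⊆ V)
    (h : ∀ a, cyl D V a = cyl D' V a) (a : Fin n → Bool) : cyl D U a = cyl D' U a := by
  rw [cyl_eq_sum, cyl_eq_sum, cylSet_eq_biUnion U V hUV a,
    Finset.sum_biUnion (pairwiseDisjoint_reps U V a), Finset.sum_biUnion (pairwiseDisjoint_reps U V a)]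
  exact Finset.sum_congr rfl fun c _ => h c

/-! ## The assembly -/

/-- **Sherali–Adams feasibility from consistent laws on closed sets (BGMT Lemma 2.3 with closures).**
Let `cl` be a closure operator (`S ⊆ cl S`) whose values on sets of size `≤ t` are `Closed` and of size `≤ B/2`; let
`P S'` be laws on full assignments (non-negative; total mass `1` whenever `|S'| ≤ B`; supported on the assignments
satisfying every output constraint dominated by `S'`) such that for every CLOSED `S₁ ⊆ S₂` with `|S₂| ≤ B` the
`S₁`-marginal of `P S₂` is the `S₁`-marginal of `P S₁` (BGMT Lemma 3.2).  Then `D S := P (cl S)` witnesses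
`SAFeasible t I y`. -/
theorem saFeasible_of_closure (I : LocalMap k n m) (y : Fin m → Bool) (t B : ℕ)
    (Closed : Finset (Fin n) → Prop) (cl : Finset (Fin n) → Finset (Fin n)) (P : Finset (Fin n) → (Fin n → Bool) → ℝ)
    (hsub : ∀ S, S ⊆ cl S)
    (hclosed : ∀ S, S.card ≤ t → Closed (cl S))
    (hcard : ∀ S, S.card ≤ t → 2 * (cl S).card ≤ B)
    (hnonneg : ∀ S x, 0 ≤ P S x)
    (htotal : ∀ S, S.card ≤ B → ∑ x, P S x = 1)
    (hsupp : ∀ S (j : Fin m) x, varSet I j ⊆ S → P S x ≠ 0 → I.eval x j = y j)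
    (h32 : ∀ S₁ S₂, Closed S₁ → S₁ ⊆ S₂ → S₂.card ≤ B → ∀ a, cyl (P S₂) S₁ a = cyl (P S₁) S₁ a) :
    SAFeasible t I y := by
  refine ⟨fun S => P (cl S), fun S hS => ⟨fun x => hnonneg _ x, htotal _ ?_⟩, fun S T hTS hS a => ?_,
    fun S j hS hj x hx => hsupp (cl S) j x (hj.trans (hsub S)) hx⟩
  · have := hcard S hS; omega
  · -- consistency through the common refinement `cl S ∪ cl T`
    have hT : T.card ≤ t := (Finset.card_le_card hTS).trans hS
    have hB : (cl S ∪ cl T).card ≤ B := by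
      have h1 := hcard S hS
      have h2 := hcard T hT
      have := Finset.card_union_le (cl S) (cl T)
      omega
    have eS : ∀ b, cyl (P (cl S ∪ cl T)) (cl S) b = cyl (P (cl S)) (cl S) b :=
      h32 (cl S) (cl S ∪ cl T) (hclosed S hS) Finset.subset_union_left hB
    have eT : ∀ b, cyl (P (cl S ∪ cl T)) (cl T) b = cyl (P (cl T)) (cl T) b :=
      h32 (cl T) (cl S ∪ cl T) (hclosed T hT) Finset.subset_union_right hB
    have e1 : cyl (P (cl S)) T a = cyl (P (cl S ∪ cl T)) T a :=
      (cyl_eq_of_subset _ _ T (cl S) (hTS.trans (hsub S)) eS a).symm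
    have e2 : cyl (P (cl T)) T a = cyl (P (cl S ∪ cl T)) T a :=
      (cyl_eq_of_subset _ _ T (cl T) (hsub T) eT a).symm
    rw [e1, e2]

end Summit.PneNP.PneNP.Theorems.PstarSAAssembly
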